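import Literature.NumberTheory.DiophantineGeometry.SumOfTwoSquaresEqPower
import Mathlib.NumberTheory.Padics.PadicVal.Basic
import Mathlib.Algebra.BigOperators.Ring.Finset
import Mathlib.Tactic
import HarnessLib

/-!
# V. A. Lebesgue's theorem (1850): `x^p = y² + 1` has no solution with `y ≠ 0`

Yu. Bilu, Y. Bugeaud, M. Mignotte, *The Problem of Catalan* (Springer 2014) [BiluBugeaudMignotte2014],
Theorem 2.1 (V. A. Lebesgue): *let `p ≥ 3` be odd; then `x^p = y² + 1` has no solution in integers with
`y ≠ 0`* — the case `q = 2` of Catalan's equation. Everything here is a `theorem`; the proof is the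
printed one:

* `y` is even and `x` odd (squares mod `4`);
* in `ℤ[i]`, `1 + iy = β^p` with `β = a + ib` (coprimality of `1 ± iy`, unique factorisation, units
  are `p`-th powers) — supplied by the tree's `sq_add_sq_eq_pow_of_odd`
  (`SumOfTwoSquaresEqPower.lean`, Cohen §14.2.2);
* `2a = β + β̄ ∣ β^p + β̄^p = 2`, so `a = ±1`; `x = a² + b² = 1 + b²` is odd, so `b` is even;
* `Re (a + ib)^p ≡ a^p (mod 4)` rules out `a = −1`; for `a = 1`, comparing real parts,
  `1 = Σ_k (−1)^k C(p,2k) b^{2k}`, i.e. `−C(p,2)b² + Σ_{k ≥ 2} (−1)^k C(p,2k) b^{2k} = 0`, which is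
  impossible 2-adically: `ord₂(C(p,2k)b^{2k}) > ord₂(C(p,2)b²)` for `k ≥ 2` (from
  `C(p,2k)·k(2k−1) = C(p,2)·C(p−2,2k−2)` and `2k − 2 > log₂ k`).

Mathlib/tree search: `lean search '\^ 2 \+ 1 = [a-z] \^|Lebesgue|Catalan'` — no form of this
statement in Mathlib or the tree (the tree has Catalan-type material only for `3² − 2³`).
-/

namespace Literature.NumberTheory.DiophantineGeometry

open Finset

namespace LebesgueNagell

/-- The Gaussian unit `i`. [folklore] -/
private theorem I_sq : (⟨0, 1⟩ : GaussianInt) ^ 2 = -1 := by decide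

/-- Real and imaginary parts of `i^m`. [folklore] -/
private theorem I_pow_re_im (m : ℕ) :
    ((⟨0, 1⟩ : GaussianInt) ^ m).re = (if m % 2 = 0 then (-1) ^ (m / 2) else 0) ∧
      ((⟨0, 1⟩ : GaussianInt) ^ m).im = (if m % 2 = 0 then 0 else (-1) ^ (m / 2)) := by
  induction m using Nat.strong_induction_on with
  | _ m ih =>
    rcases Nat.lt_or_ge m 2 with hm | hm
    · interval_cases m <;> decide
    · obtain ⟨k, rfl⟩ : ∃ k, m = k + 2 := ⟨m - 2, by omega⟩
      obtain ⟨h1, h2⟩ := ih k (by omega)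
      rw [pow_add, I_sq, mul_neg_one, Zsqrtd.re_neg, Zsqrtd.im_neg, h1, h2]
      have e1 : (k + 2) % 2 = k % 2 := by omega
      have e2 : (k + 2) / 2 = k / 2 + 1 := by omega
      rw [e1, e2]
      constructor <;> split_ifs <;> ring

/-- `re` of a finite sum. [folklore] -/
private theorem re_sum {ι : Type*} (s : Finset ι) (f : ι → GaussianInt) :
    (∑ i ∈ s, f i).re = ∑ i ∈ s, (f i).re := by
  classical
  induction s using Finset.induction_on with
  | empty => simp
  | insert a s ha ih => rw [sum_insert ha, sum_insert ha, Zsqrtd.re_add, ih]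

/-- The real part of `(1 + ib)^p` as a binomial sum:
`Re (1 + ib)^p = Σ_{m ≤ p} C(p,m) b^m Re(i^m)`. [cite: BiluBugeaudMignotte2014, Thm. 2.1 (proof)] -/
theorem re_one_add_pow (b : ℤ) (p : ℕ) :
    ((⟨1, b⟩ : GaussianInt) ^ p).re =
      ∑ m ∈ range (p + 1), (p.choose m : ℤ) * b ^ m * (if m % 2 = 0 then (-1) ^ (m / 2) else 0) := by
  have e : (⟨1, b⟩ : GaussianInt) = (b : GaussianInt) * ⟨0, 1⟩ + 1 := by
    ext <;> simp
  rw [e, add_pow, re_sum]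
  refine sum_congr rfl fun m _ => ?_
  rw [one_pow, mul_one, mul_pow]
  obtain ⟨h1, -⟩ := I_pow_re_im m
  have hbm : ((b : GaussianInt) ^ m) = ((b ^ m : ℤ) : GaussianInt) := by push_cast; rfl
  have e2 : (((b : GaussianInt) ^ m * (⟨0, 1⟩ : GaussianInt) ^ m) * (p.choose m : GaussianInt)).re
      = b ^ m * ((⟨0, 1⟩ : GaussianInt) ^ m).re * (p.choose m) := by
    rw [hbm, Zsqrtd.re_mul, Zsqrtd.re_mul, Zsqrtd.im_mul, Zsqrtd.re_intCast, Zsqrtd.im_intCast,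
      Zsqrtd.re_natCast, Zsqrtd.im_natCast]
    ring
  rw [e2, h1]
  ring

/-- The binomial identity `C(p,2k)·C(2k,2) = C(p,2)·C(p−2,2k−2)` (`2 ≤ 2k ≤ p`).
[cite: BiluBugeaudMignotte2014, Thm. 2.1 (proof)] -/
theorem choose_identity {p k : ℕ} (hk : 1 ≤ k) :
    p.choose (2 * k) * (2 * k).choose 2 = p.choose 2 * (p - 2).choose (2 * k - 2) :=
  Nat.choose_mul (by omega)

/-- The 2-adic heart of Lebesgue's proof: for `b ≠ 0` even and `k ≥ 2`,
`2^{v+1} ∣ C(p,2k) b^{2k}` where `2^v ∥ C(p,2) b²`. [cite: BiluBugeaudMignotte2014, Thm. 2.1 (proof), Lemma A.1] -/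
theorem two_pow_dvd_term {p k b : ℕ} (hp : 2 ≤ p) (hk : 2 ≤ k) (hb : 2 ∣ b) (hb0 : b ≠ 0) :
    2 ^ (padicValNat 2 (p.choose 2 * b ^ 2) + 1) ∣ p.choose (2 * k) * b ^ (2 * k) := by
  rcases Nat.lt_or_ge p (2 * k) with hlt | hkp
  · rw [Nat.choose_eq_zero_of_lt hlt, zero_mul]; exact dvd_zero _
  set v := padicValNat 2 (p.choose 2 * b ^ 2) with hv
  have hV0 : p.choose 2 * b ^ 2 ≠ 0 :=
    mul_ne_zero (Nat.choose_pos hp).ne' (pow_ne_zero _ hb0)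
  have hVdvd : 2 ^ v ∣ p.choose 2 * b ^ 2 := pow_padicValNat_dvd
  obtain ⟨c, hc⟩ := hb
  -- `X · C(2k,2) = C(p,2) b² · C(p-2,2k-2) · b^{2k-2}`
  set X := p.choose (2 * k) * b ^ (2 * k) with hX
  have hid : X * (2 * k).choose 2 = (p.choose 2 * b ^ 2) * ((p - 2).choose (2 * k - 2) * b ^ (2 * k - 2)) := by
    have h1 := choose_identity (p := p) (k := k) (by omega)
    have e : b ^ (2 * k) = b ^ 2 * b ^ (2 * k - 2) := by rw [← pow_add]; congr 1; omega
    rw [hX, e]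
    calc p.choose (2 * k) * (b ^ 2 * b ^ (2 * k - 2)) * (2 * k).choose 2
        = (p.choose (2 * k) * (2 * k).choose 2) * (b ^ 2 * b ^ (2 * k - 2)) := by ring
      _ = (p.choose 2 * (p - 2).choose (2 * k - 2)) * (b ^ 2 * b ^ (2 * k - 2)) := by rw [h1]
      _ = _ := by ring
  -- `2^{2k-2} ∣ b^{2k-2}`
  have h2 : 2 ^ (2 * k - 2) ∣ b ^ (2 * k - 2) := by
    rw [hc]; exact pow_dvd_pow_of_dvd (dvd_mul_right 2 c) _
  have h3 : 2 ^ (v + (2 * k - 2)) ∣ X * (2 * k).choose 2 := by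
    rw [hid, pow_add]
    exact mul_dvd_mul hVdvd (dvd_mul_of_dvd_right h2 _)
  -- `C(2k,2) = k(2k-1)`, `k = 2^e k'` with `k'` odd and `e < k`
  have hC : (2 * k).choose 2 = k * (2 * k - 1) := by
    rw [Nat.choose_two_right]
    have : 2 * k * (2 * k - 1) = 2 * (k * (2 * k - 1)) := by ring
    rw [this, Nat.mul_div_cancel_left _ two_pos]
  obtain ⟨e, k', hk', hke⟩ := Nat.exists_eq_two_pow_mul_odd (n := k) (by omega)
  have he : e < k := by
    have h1 : 2 ^ e ≤ k := by rw [hke]; exact Nat.le_mul_of_pos_right _ hk'.pos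
    exact lt_of_lt_of_le e.lt_two_pow_self h1
  have hodd : Odd (k' * (2 * k - 1)) := hk'.mul (by rw [Nat.odd_iff]; omega)
  -- `2^{v+2k-2} ∣ 2^e · (odd · X)`
  have h4 : 2 ^ (v + (2 * k - 2)) ∣ 2 ^ e * (k' * (2 * k - 1) * X) := by
    have : X * (2 * k).choose 2 = 2 ^ e * (k' * (2 * k - 1) * X) := by rw [hC, hke]; ring
    rwa [this] at h3
  have h5 : 2 ^ (v + (2 * k - 2) - e) ∣ k' * (2 * k - 1) * X := by
    have e1 : 2 ^ (v + (2 * k - 2)) = 2 ^ (v + (2 * k - 2) - e) * 2 ^ e := by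
      rw [← pow_add]; congr 1; omega
    rw [e1, mul_comm (2 ^ e)] at h4
    exact Nat.dvd_of_mul_dvd_mul_right (pow_pos two_pos e) h4
  have h6 : 2 ^ (v + (2 * k - 2) - e) ∣ X :=
    (Nat.Coprime.pow_left _ (Nat.coprime_two_left.mpr hodd)).dvd_of_dvd_mul_left h5
  exact (pow_dvd_pow 2 (by omega)).trans h6

/-- The real part of `(1 + ib)^p` for `b ≠ 0` even and `p ≥ 3`: it is `≡ 1 (mod 4)` and `≠ 1`
(the printed congruence `(a + ib)^p ≡ a^p + ipa^{p−1}b (mod 4)` and the 2-adic impossibility of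
(2.2)). [cite: BiluBugeaudMignotte2014, Thm. 2.1 (proof)] -/
theorem re_pow_one_add {b : ℤ} {p : ℕ} (hp : 3 ≤ p) (hb : 2 ∣ b) (hb0 : b ≠ 0) :
    (4 : ℤ) ∣ ((⟨1, b⟩ : GaussianInt) ^ p).re - 1 ∧ ((⟨1, b⟩ : GaussianInt) ^ p).re ≠ 1 := by
  set f : ℕ → ℤ := fun m => (p.choose m : ℤ) * b ^ m * (if m % 2 = 0 then (-1) ^ (m / 2) else 0)
    with hf
  have hR : ((⟨1, b⟩ : GaussianInt) ^ p).re = ∑ m ∈ range (p + 1), f m := re_one_add_pow b p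
  -- peel off `m = 0, 1, 2`
  obtain ⟨n, hn⟩ : ∃ n, p + 1 = n + 3 := ⟨p - 2, by omega⟩
  have hsplit : ∑ m ∈ range (p + 1), f m = (∑ i ∈ range n, f (i + 3)) + f 2 + f 1 + f 0 := by
    rw [hn, sum_range_succ', sum_range_succ', sum_range_succ']
  have hf0 : f 0 = 1 := by simp [hf]
  have hf1 : f 1 = 0 := by simp [hf]
  have hf2 : f 2 = -((p.choose 2 : ℤ) * b ^ 2) := by simp [hf]
  -- the 2-adic valuation `v` of `C(p,2) b²`
  set V : ℕ := p.choose 2 * b.natAbs ^ 2 with hV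
  have hV0 : V ≠ 0 := mul_ne_zero (Nat.choose_pos (by omega)).ne' (pow_ne_zero _ (Int.natAbs_ne_zero.mpr hb0))
  set v : ℕ := padicValNat 2 V with hv
  have hVcast : ((p.choose 2 : ℤ) * b ^ 2) = (V : ℤ) := by
    rw [hV]; push_cast; rw [sq_abs]
  -- every tail term is divisible by `2^{v+1}`
  have htail : ∀ i ∈ range n, (2 : ℤ) ^ (v + 1) ∣ f (i + 3) := by
    intro i _
    simp only [hf]
    split_ifs with hpar
    · -- `i + 3 = 2k` with `k ≥ 2`
      obtain ⟨k, hk⟩ : ∃ k, i + 3 = 2 * k := ⟨(i + 3) / 2, by omega⟩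
      have hk2 : 2 ≤ k := by omega
      have hnat : 2 ^ (v + 1) ∣ p.choose (2 * k) * b.natAbs ^ (2 * k) :=
        two_pow_dvd_term (by omega) hk2 (by
          obtain ⟨c, hc⟩ := hb; exact ⟨c.natAbs, by rw [hc, Int.natAbs_mul]; rfl⟩)
          (Int.natAbs_ne_zero.mpr hb0)
      have hint : (2 : ℤ) ^ (v + 1) ∣ (p.choose (2 * k) : ℤ) * b ^ (2 * k) := by
        have h1 := Int.natCast_dvd_natCast.mpr hnat
        push_cast at h1
        have e : |b| ^ (2 * k) = b ^ (2 * k) := by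
          rw [pow_mul, sq_abs, ← pow_mul]
        rwa [e] at h1
      rw [hk]
      exact Dvd.dvd.mul_right hint _
    · rw [mul_zero]; exact dvd_zero _
  have hE : (2 : ℤ) ^ (v + 1) ∣ ∑ i ∈ range n, f (i + 3) := dvd_sum htail
  -- `v ≥ 2` because `4 ∣ b²`
  have hv2 : 2 ≤ v := by
    have h4 : 2 ^ 2 ∣ V := by
      rw [hV]
      obtain ⟨c, hc⟩ := hb
      exact Dvd.dvd.mul_left ⟨c.natAbs ^ 2, by rw [hc, Int.natAbs_mul]; simp [mul_pow]⟩ _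
    haveI : Fact (Nat.Prime 2) := ⟨Nat.prime_two⟩
    exact (padicValNat_dvd_iff_le hV0).mp h4
  have h4E : (4 : ℤ) ∣ ∑ i ∈ range n, f (i + 3) := by
    refine dvd_trans ?_ hE
    refine ⟨2 ^ (v - 1), ?_⟩
    have e : v + 1 = 2 + (v - 1) := by omega
    rw [e, pow_add]
    norm_num
  have h4V : (4 : ℤ) ∣ (p.choose 2 : ℤ) * b ^ 2 := by
    obtain ⟨c, hc⟩ := hb
    exact Dvd.dvd.mul_left ⟨c ^ 2, by rw [hc]; ring⟩ _
  constructor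
  · rw [hR, hsplit, hf0, hf1, hf2]
    have e : (∑ i ∈ range n, f (i + 3)) + -((p.choose 2 : ℤ) * b ^ 2) + 0 + 1 - 1
        = (∑ i ∈ range n, f (i + 3)) - (p.choose 2 : ℤ) * b ^ 2 := by ring
    rw [e]
    exact dvd_sub h4E h4V
  · intro h1
    rw [hR, hsplit, hf0, hf1, hf2] at h1
    have e : (p.choose 2 : ℤ) * b ^ 2 = ∑ i ∈ range n, f (i + 3) := by linarith
    have hdvd : (2 : ℤ) ^ (v + 1) ∣ (V : ℤ) := by rw [← hVcast, e]; exact hE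
    have hdvd' : 2 ^ (v + 1) ∣ V := by exact_mod_cast hdvd
    haveI : Fact (Nat.Prime 2) := ⟨Nat.prime_two⟩
    exact pow_succ_padicValNat_not_dvd hV0 hdvd'

/-- **Theorem 2.1 (V. A. Lebesgue, 1850) [Bilu–Bugeaud–Mignotte].** Let `p ≥ 3` be odd. Then
`x^p = y² + 1` has no solution in integers with `y ≠ 0`. [cite: BiluBugeaudMignotte2014, Thm. 2.1] -/
theorem lebesgue {p : ℕ} (hpo : Odd p) (hp : 3 ≤ p) {x y : ℤ} (hy : y ≠ 0) : x ^ p ≠ y ^ 2 + 1 := by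
  intro h
  -- `y` even, `x` odd
  have hye : 2 ∣ y := by
    by_contra hyo
    have hyodd : Odd y := Int.not_even_iff_odd.mp (fun he => hyo (even_iff_two_dvd.mp he))
    obtain ⟨k, hk⟩ := hyodd
    rcases Int.even_or_odd x with ⟨l, hl⟩ | ⟨l, hl⟩
    · -- `x` even: `4 ∣ x^p` but `y² + 1 ≡ 2 (mod 4)`
      have h4 : (4 : ℤ) ∣ x ^ p := by
        have : (4 : ℤ) ∣ x ^ 2 := ⟨l ^ 2, by rw [hl]; ring⟩
        exact this.trans (pow_dvd_pow x (by omega))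
      rw [h, hk] at h4
      have : (4 : ℤ) ∣ (2 * k + 1) ^ 2 + 1 - 4 * (k ^ 2 + k) := dvd_sub h4 (dvd_mul_right 4 _)
      have e : (2 * k + 1) ^ 2 + 1 - 4 * (k ^ 2 + k) = 2 := by ring
      rw [e] at this
      norm_num at this
    · -- `x` odd: `x^p` odd but `y² + 1` even
      have hodd : Odd (x ^ p) := (show Odd x from ⟨l, hl⟩).pow
      rw [h] at hodd
      exact (Int.not_even_iff_odd.mpr hodd) ⟨2 * k ^ 2 + 2 * k + 1, by rw [hk]; ring⟩
  have hxodd : Odd x := by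
    rcases Int.even_or_odd x with ⟨l, hl⟩ | hx
    · exfalso
      have h2 : (2 : ℤ) ∣ x ^ p := (show (2 : ℤ) ∣ x from ⟨l, by rw [hl]; ring⟩).trans
        (dvd_pow_self x (by omega))
      rw [h] at h2
      obtain ⟨c, hc⟩ := hye
      have : (2 : ℤ) ∣ y ^ 2 + 1 - 2 * (2 * c ^ 2) := dvd_sub h2 (dvd_mul_right 2 _)
      have e : y ^ 2 + 1 - 2 * (2 * c ^ 2) = 1 := by rw [hc]; ring
      rw [e] at this
      norm_num at this
    · exact hx
  -- `1 + iy = β^p`, `β = s + it`, in `ℤ[i]`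
  have h' : (1 : ℤ) ^ 2 + y ^ 2 = x ^ p := by linear_combination -h
  obtain ⟨s, t, hβ, hx⟩ := sq_add_sq_eq_pow_of_odd (by omega) hpo (isCoprime_one_left) h'
  -- `2s = β + β̄ ∣ β^p + β̄^p = 2`, so `s = ±1`
  have hs : s = 1 ∨ s = -1 := by
    have hdvd : (⟨s, t⟩ : GaussianInt) + star (⟨s, t⟩ : GaussianInt) ∣
        (⟨s, t⟩ : GaussianInt) ^ p + (star (⟨s, t⟩ : GaussianInt)) ^ p :=
      hpo.add_dvd_pow_add_pow _ _
    rw [← star_pow, ← hβ, Zsqrtd.star_mk, Zsqrtd.star_mk] at hdvd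
    have e1 : (⟨s, t⟩ : GaussianInt) + ⟨s, -t⟩ = ((2 * s : ℤ) : GaussianInt) := by
      ext
      · simp; ring
      · simp
    have e2 : (⟨1, y⟩ : GaussianInt) + ⟨1, -y⟩ = ((2 : ℤ) : GaussianInt) := by
      ext <;> simp
    rw [e1, e2, Zsqrtd.intCast_dvd_intCast] at hdvd
    obtain ⟨c, hc⟩ := hdvd
    have : s * c = 1 := by linarith
    rcases Int.isUnit_iff.mp (isUnit_of_dvd_one ⟨c, this.symm⟩) with h1 | h1
    · exact Or.inl h1
    · exact Or.inr h1
  -- `t` even (`x = s² + t² = 1 + t²` is odd) and `t ≠ 0` (`y ≠ 0`)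
  have hte : 2 ∣ t := by
    have hs2 : s ^ 2 = 1 := by rcases hs with hs | hs <;> rw [hs] <;> norm_num
    rw [hs2] at hx
    rcases Int.even_or_odd t with ht | ⟨l, hl⟩
    · exact even_iff_two_dvd.mp ht
    · exfalso
      rw [hx] at hxodd
      exact (Int.not_even_iff_odd.mpr hxodd) ⟨2 * l ^ 2 + 2 * l + 1, by rw [hl]; ring⟩
  have ht0 : t ≠ 0 := by
    rintro rfl
    rcases hs with hs | hs <;> rw [hs] at hβ
    · have e1 : (⟨1, 0⟩ : GaussianInt) = 1 := by ext <;> rfl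
      rw [e1, one_pow] at hβ
      have := congrArg Zsqrtd.im hβ
      simp at this
      exact hy this
    · have e : (⟨-1, 0⟩ : GaussianInt) = -1 := by ext <;> rfl
      rw [e, Odd.neg_one_pow hpo] at hβ
      have := congrArg Zsqrtd.re hβ
      simp at this
  rcases hs with hs | hs
  · -- `s = 1`: real parts give `Re (1 + it)^p = 1`
    subst hs
    have hre := congrArg Zsqrtd.re hβ
    simp only at hre
    exact (re_pow_one_add hp hte ht0).2 hre.symm
  · -- `s = -1`: `(−1 + it)^p = −(1 − it)^p`, real part `−1 ≢ 1 (mod 4)`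
    subst hs
    have e : (⟨-1, t⟩ : GaussianInt) = -⟨1, -t⟩ := by ext <;> simp
    rw [e, Odd.neg_pow hpo] at hβ
    have hre := congrArg Zsqrtd.re hβ
    simp only [Zsqrtd.re_neg] at hre
    -- `Re (1 + i(-t))^p = -1`, but it is `≡ 1 (mod 4)`
    have hte' : 2 ∣ -t := (dvd_neg).mpr hte
    have h4 := (re_pow_one_add hp hte' (neg_ne_zero.mpr ht0)).1
    have eR : ((⟨1, -t⟩ : GaussianInt) ^ p).re = -1 := by linarith
    rw [eR] at h4
    norm_num at h4

end LebesgueNagell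

/-- **Lebesgue's theorem for every exponent `n ≥ 2`** (the case `q = 2` of Catalan's equation
`x^n − y^q = 1`): `x^n = y² + 1` forces `y = 0`. For even `n` this is `(x^{n/2})² − y² = 1`; for odd
`n ≥ 3` it is Theorem 2.1. [cite: BiluBugeaudMignotte2014, Thm. 2.1] -/
theorem lebesgue_sq_add_one {n : ℕ} (hn : 2 ≤ n) {x y : ℤ} (h : x ^ n = y ^ 2 + 1) : y = 0 := by
  rcases Nat.even_or_odd n with ⟨k, hk⟩ | hno
  · -- `n = 2k`: `(x^k)² − y² = 1`
    have e : (x ^ k - y) * (x ^ k + y) = 1 := by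
      have : x ^ n = (x ^ k) ^ 2 := by rw [hk, ← two_mul, pow_mul]; ring
      linear_combination (this.symm.trans h)
    rcases Int.isUnit_iff.mp (isUnit_of_dvd_one ⟨_, e.symm⟩) with h1 | h1 <;>
      rcases Int.isUnit_iff.mp (isUnit_of_dvd_one ⟨_, ((mul_comm _ _).trans e).symm⟩) with h2 | h2 <;>
      first
        | linarith
        | (rw [h1, h2] at e; norm_num at e)
  · by_contra hy
    exact LebesgueNagell.lebesgue hno (by obtain ⟨k, hk⟩ := hno; omega) hy h

end Literature.NumberTheory.DiophantineGeometry
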